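import Mathlib
import Literature.NumberTheory.LFunctions.Zhang2022.TypedSection13
import HarnessLib

/-!
# Zhang (2022) §13, the step after (13.3) ("multiplying by `Z(ρ,χψ)⁻¹B(ρ,ψ)` and applying
# Lemma 4.8"): the REPAIRED inference, kernel-checked — GAP-LEDGER row G-L3t6-2

Topic `Literature/NumberTheory/LFunctions/Zhang2022` (Landau–Siegel audit tree; verdict-neutral).
Y. Zhang, *Discrete mean estimates and the Landau–Siegel zero*, arXiv:2211.02515v1 (2022)
[Zhang2022LandauSiegel], §13 p. 75, tex L3774–L3790 (DAG `Z22:§13.u005`, `Z22:(13.7)`) — **an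
unrefereed manuscript under adjudication** (campaign D-0069). THEOREMS ONLY; no new fact, no `def`.

The printed display after (13.3),
`𝒞*(ρ,ψ)Z(ρ,χψ)⁻¹B(ρ,ψ) = −i(𝒦*₁ + (pt₀)^{β₁}𝒦*₂ − (pt₀)^{β₃}𝒦*₃) + O(E₁*(ρ,ψ)|B(ρ,ψ)|)`
(typed AS PRINTED as `Typed.Section13.U005`), does NOT follow from (13.3) (`Typed.Section13.Eq133`)
and Lemma 4.8 (`Skeleton.Lemma48`: `Z̃(ρ)⁻¹ = −G(ρ,ψ)F(1−ρ,ψ̄) + O(𝓛⁻¹⁰⁰)`): the third term of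
(13.3) carries `Z(ρ,ψ)⁻¹`, and `Z(ρ,ψ)⁻¹Z(ρ,χψ)⁻¹ = Z̃(ρ)⁻¹` leaves the remainder
`O(𝓛⁻¹⁰⁰·|L(ρ+β₁,ψ)N(ρ+β₂,ψ)N(ρ+β₃,ψ)B(ρ,ψ)/L′(ρ,ψ)|)`, which is not displayed and is not
dominated termwise by `E₁*|B|` (GAP-LEDGER G-L3t6-2, L3-t6). This file proves EXACTLY what does
follow, with that remainder made explicit:

* `u005c_of : Eq133 c′ c₀ → Skeleton.Lemma48 → Skeleton.Prop22i → (∃ C, ForAllLarge …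
  ‖𝒞*Z(ρ,χψ)⁻¹B + i(𝒦*₁ + (pt₀)^{β₁}𝒦*₂ − (pt₀)^{β₃}𝒦*₃)‖ ≤
  C·(E₁*(ρ,ψ)‖B(ρ,ψ)‖ + 𝓛⁻¹⁰⁰‖L(ρ+β₁,ψ)N(ρ+β₂,ψ)N(ρ+β₃,ψ)B(ρ,ψ)/L′(ρ,ψ)‖))` — the algebra is an
  exact identity (`Z̃ = Z(·,ψ)Z(·,ψχ)` by definition), plus `|Z(ρ,χψ)| = 1` and `|(pt₀)^{β₃}| = 1`
  on the critical line (Proposition 2.2 (i); `χψ` primitive mod `Dp`, `Skeleton.psiChiPrimitive_holds`);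
* `eq137c_of` — the same three hypotheses give the summed form
  `‖Ξ₁₄ + i(Φ₁ + Φ₂ − Φ₃)‖ ≤ C·(𝓔 + 𝓛⁻¹⁰⁰·𝓔′)`, `𝓔′ := ΣΣ‖L(ρ+β₁)N(ρ+β₂)N(ρ+β₃)B/L′(ρ)‖·|ω(ρ)|`
  ("Inserting this into (12.4)"), i.e. the consumer (13.7) with the extra term that (13.11) would
  ALSO have to show is `o(𝔓)` — the "restate consumer" shape named in G-L3t6-2, kernel-checked.

Nothing here asserts `U005`, `Eq137` or `Eq1311` as printed, or anything about Theorems 1–2 /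
Landau–Siegel zeros. [cite: Zhang2022LandauSiegel, §13 p.75 (display after (13.3)), (13.7)]
-/

noncomputable section

open Complex ComplexConjugate

namespace Literature.NumberTheory.LFunctions.Zhang2022.Typed.Section13

open Skeleton GammaFactor

/-- For `D ≥ ⌈e^M⌉`, `𝓛 = log D ≥ M`. [cite: Zhang2022LandauSiegel, §2 p.4] -/
private theorem le_ell_of_ceil_exp_le' {M : ℝ} {D : ℕ} (hD : ⌈Real.exp M⌉₊ ≤ D) : M ≤ ell D := by
  have h : Real.exp M ≤ D := le_trans (Nat.le_ceil _) (by exact_mod_cast hD)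
  exact (Real.le_log_iff_exp_le (lt_of_lt_of_le (Real.exp_pos _) h)).mpr h

/-- `D ≥ ⌈e²⌉` forces `D ≥ 3` (so that `χψ` is primitive mod `Dp`, `Skeleton.psiChiPrimitive_holds`).
[cite: Zhang2022LandauSiegel, §4 p.8] -/
private theorem three_le_of_ceil_exp_two_le {D : ℕ} (hD : ⌈Real.exp 2⌉₊ ≤ D) : 3 ≤ D := by
  have h3 : (3 : ℝ) ≤ Real.exp 2 := by
    have := Real.add_one_le_exp (2 : ℝ); linarith
  have : (3 : ℝ) ≤ (D : ℝ) := le_trans (le_trans h3 (Nat.le_ceil _)) (by exact_mod_cast hD)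
  exact_mod_cast this

/-- With `𝓛 ≥ 2`: `t₀ ≥ 1024` and `𝓛₁ ≤ t₀`, whence every `ρ ∈ 𝔷(ψ)` has `Im ρ > 0`.
[cite: Zhang2022LandauSiegel, §2 (2.8), (2.14)] -/
private theorem im_pos_of_mem_zeroSet {D : ℕ} (hL : 2 ≤ ell D) (x : Chr D) {ρ : ℂ}
    (hρ : ρ ∈ zeroSet D x) : 0 < ρ.im ∧ 0 < t0 D := by
  have hℓ1 : 1 ≤ ell D := by linarith
  have ht0 : (1024 : ℝ) ≤ t0 D := by
    calc (1024 : ℝ) = 2 ^ 10 := by norm_num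
      _ ≤ ell D ^ 10 := pow_le_pow_left₀ (by norm_num) hL 10
      _ ≤ ell D ^ 519 := pow_le_pow_right₀ hℓ1 (by norm_num)
      _ = t0 D := rfl
  have hℓ1t0 : ell1 D ≤ t0 D := pow_le_pow_right₀ hℓ1 (by norm_num)
  obtain ⟨-, him, -⟩ := hρ
  have := (abs_lt.mp him).1
  exact ⟨by nlinarith [Real.pi_gt_three], by linarith⟩

/-- `𝔷(ψ) ⊆` the zero set of `L(s,ψ)L(s,ψχ)` in `Ω` ((2.7), (2.14)): the set Proposition 2.2 and
Lemma 4.8 speak about. [cite: Zhang2022LandauSiegel, §2 (2.7), (2.14)] -/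
private theorem mem_prodZeroSetOmega_of_mem_zeroSet' {D : ℕ} [NeZero D]
    (χ : DirichletCharacter ℂ D) (x : Chr D) {ρ : ℂ} (hρ : ρ ∈ zeroSet D x) :
    ρ ∈ prodZeroSetOmega χ x := by
  obtain ⟨h1, h2, h3⟩ := hρ
  have hre : (ρ - s0 D).re = ρ.re - 1 / 2 := by simp [s0, SmoothWeight.s0]
  have him : (ρ - s0 D).im = ρ.im - 2 * Real.pi * t0 D := by simp [s0, SmoothWeight.s0]
  refine ⟨⟨by rw [hre]; exact h1, by rw [him]; linarith⟩, by rw [h3, zero_mul]⟩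

/-- `|(pt₀)^{β₃}| = 1` (`β₃` purely imaginary, `pt₀ > 0`). [cite: Zhang2022LandauSiegel, §2 (2.13)] -/
private theorem norm_pt0_cpow_beta3 (c' : ℝ) {D : ℕ} (x : Chr D) (ht0 : 0 < t0 D) :
    ‖(((x.p : ℝ) * t0 D : ℝ) : ℂ) ^ beta3 c' D‖ = 1 := by
  have hp : (0 : ℝ) < x.p := Nat.cast_pos.mpr x.prime.pos
  rw [Complex.norm_cpow_eq_rpow_re_of_pos (mul_pos hp ht0)]
  simp [beta3]

/-- On the critical line `|Z(ρ,χψ)| = 1` (`χψ` primitive mod `Dp` for `D ≥ 3`).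
[cite: Zhang2022LandauSiegel, §2 p.5; §4 p.8] -/
private theorem norm_Zpc_eq_one {D : ℕ} [NeZero D] {χ : DirichletCharacter ℂ D}
    (hχ : χ.IsPrimitive) (hD : 3 ≤ D) (x : Chr D) {ρ : ℂ} (hre : ρ.re = 1 / 2) (him : 0 < ρ.im) :
    ‖Zpc χ x ρ‖ = 1 := by
  have hρ : ρ = 1 / 2 + (ρ.im : ℝ) * I := by
    apply Complex.ext <;> simp [hre]
  rw [Zpc, hρ]
  exact norm_Zfac_half_eq_one (psiChiPrimitive_holds D χ x hD hχ) him

/-- The exact algebra of "multiplying (13.3) by `Z(ρ,χψ)⁻¹B` and applying Lemma 4.8": with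
`𝒞* = m + R` (`m` the main term (13.3)), `Z(ρ,ψ)⁻¹Z(ρ,χψ)⁻¹ = R₄₈ − G·F̄` (Lemma 4.8's object),
`𝒞*Z(ρ,χψ)⁻¹B + i(𝒦*₁ + P₁𝒦*₂ − P₃𝒦*₃) = R·Z(ρ,χψ)⁻¹B − iP₃R₄₈·(L₁/L′)N₂N₃B`.
[cite: Zhang2022LandauSiegel, §13 p.75 (display after (13.3)), (13.4)–(13.6)] -/
private theorem key_identity {cs R Zpi Z0i B L1 L2 Lp K3b K2b N2 N3 P1 P3 G Fb R48 : ℂ}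
    (hcs : cs = (-I * (L1 * L2 / Lp) * K3b - I * P1 * (L1 / Lp) * N3 * K2b -
      I * P3 * Z0i * (L1 / Lp) * N2 * N3) + R)
    (hZ : Z0i * Zpi = R48 - G * Fb) :
    cs * Zpi * B + I * (Zpi * (L1 * L2 / Lp) * B * K3b + P1 * (Zpi * (L1 / Lp) * B * N3 * K2b) -
        P3 * (L1 / Lp * B * G * N2 * N3 * Fb)) =
      R * Zpi * B - I * P3 * R48 * (L1 * N2 * N3 * B / Lp) := by
  rw [hcs]
  linear_combination (-I * P3 * (L1 * N2 * N3 * B / Lp)) * hZ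

/-- **`Z22:§13.u005`, repaired** (GAP-LEDGER G-L3t6-2): from (13.3) (`Eq133 c′ c₀`), Lemma 4.8 and
Proposition 2.2 (i), for `ψ ∈ Ψ₁`, `ρ ∈ 𝔷(ψ)`:
`‖𝒞*(ρ,ψ)Z(ρ,χψ)⁻¹B(ρ,ψ) + i(𝒦*₁ + (pt₀)^{β₁}𝒦*₂ − (pt₀)^{β₃}𝒦*₃)‖`
`≤ C·(E₁*(ρ,ψ)‖B(ρ,ψ)‖ + 𝓛⁻¹⁰⁰·‖L(ρ+β₁,ψ)N(ρ+β₂,ψ)N(ρ+β₃,ψ)B(ρ,ψ)/L′(ρ,ψ)‖)`, `C = max(C₁₃.₃, C₄.₈)`.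
The second term is the Lemma-4.8 remainder the printed display omits; without it the display
(`U005`) is not derivable. [cite: Zhang2022LandauSiegel, §13 p.75, tex L3774–L3777] -/
theorem u005c_of (c' c₀ : ℝ) (h133 : Eq133 c' c₀) (h48 : Lemma48) (h22 : Prop22i) :
    ∃ C : ℝ, ForAllLarge fun D _ χ => AssumptionA D χ → ∀ x ∈ PsiOne χ, ∀ ρ ∈ zeroSet D x,
      ‖cstar c' D x ρ * (Zpc χ x ρ)⁻¹ * Bpoly χ x ρ +
          I * (kstar1 c' χ x ρ + (((x.p : ℝ) * t0 D : ℝ) : ℂ) ^ beta1 c' D * kstar2 c' χ x ρ -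
            (((x.p : ℝ) * t0 D : ℝ) : ℂ) ^ beta3 c' D * kstar3 c' χ x ρ)‖ ≤
        C * (E1star c' c₀ x ρ * ‖Bpoly χ x ρ‖ + (ell D ^ 100)⁻¹ *
          ‖x.ψ.LFunction (ρ + beta1 c' D) * Nchar D (psiFn x) (ρ + beta2 c' D) *
              Nchar D (psiFn x) (ρ + beta3 c' D) * Bpoly χ x ρ / deriv x.ψ.LFunction ρ‖) := by
  obtain ⟨C1, h133⟩ := h133
  obtain ⟨C2, h48⟩ := h48
  obtain ⟨D₀, h⟩ := (h133.and h48).and h22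
  refine ⟨max C1 C2, max D₀ ⌈Real.exp 2⌉₊, fun D _ χ hD hq hp hA x hx ρ hρ => ?_⟩
  obtain ⟨⟨h1, h2⟩, h3⟩ := h D χ (le_trans (le_max_left _ _) hD) hq hp
  have hD2 : ⌈Real.exp 2⌉₊ ≤ D := le_trans (le_max_right _ _) hD
  have hL : 2 ≤ ell D := le_ell_of_ceil_exp_le' hD2
  have hD3 : 3 ≤ D := three_le_of_ceil_exp_two_le hD2
  have hρΩ := mem_prodZeroSetOmega_of_mem_zeroSet' χ x hρ
  have hre : ρ.re = 1 / 2 := h3 x hx ρ hρΩ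
  obtain ⟨him, ht0⟩ := im_pos_of_mem_zeroSet hL x hρ
  have hR := h1 hA x hx ρ hρ
  have h48ρ := h2 x hx ρ hρΩ
  -- names
  set cs := cstar c' D x ρ with hcs_def
  set m := main133 c' x ρ with hm_def
  set Zp := Zpc χ x ρ with hZp_def
  set Z0 := Zfac x.ψ ρ with hZ0_def
  set B := Bpoly χ x ρ with hB_def
  set L1 := x.ψ.LFunction (ρ + beta1 c' D) with hL1_def
  set L2 := x.ψ.LFunction (ρ + beta2 c' D) with hL2_def
  set Lp := deriv x.ψ.LFunction ρ with hLp_def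
  set K3b := Kchar D (psiBarFn x) (1 - ρ - beta3 c' D) with hK3b_def
  set K2b := Kchar D (psiBarFn x) (1 - ρ - beta2 c' D) with hK2b_def
  set N2 := Nchar D (psiFn x) (ρ + beta2 c' D) with hN2_def
  set N3 := Nchar D (psiFn x) (ρ + beta3 c' D) with hN3_def
  set P1 := (((x.p : ℝ) * t0 D : ℝ) : ℂ) ^ beta1 c' D with hP1_def
  set P3 := (((x.p : ℝ) * t0 D : ℝ) : ℂ) ^ beta3 c' D with hP3_def
  set G := Gpoly χ x ρ with hG_def
  set Fb := FpolyBar χ x (1 - ρ) with hFb_def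
  set R48 := (tildeZW χ x ρ)⁻¹ + G * Fb with hR48_def
  -- Lemma 4.8's object: `Z(ρ,ψ)⁻¹Z(ρ,χψ)⁻¹ = Z̃(ρ)⁻¹ = R₄₈ − G·F̄`
  have hZ : Z0⁻¹ * Zp⁻¹ = R48 - G * Fb := by
    rw [hR48_def, add_sub_cancel_right, tildeZW, tildeZ_def, mul_inv]
    rfl
  have hcs : cs = (-I * (L1 * L2 / Lp) * K3b - I * P1 * (L1 / Lp) * N3 * K2b -
      I * P3 * Z0⁻¹ * (L1 / Lp) * N2 * N3) + (cs - m) := by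
    rw [hm_def, main133]; ring
  have key := key_identity (Zpi := Zp⁻¹) (B := B) (K3b := K3b) (K2b := K2b) (G := G) (Fb := Fb)
    hcs hZ
  have hgoal : cs * Zp⁻¹ * B + I * (kstar1 c' χ x ρ + P1 * kstar2 c' χ x ρ - P3 * kstar3 c' χ x ρ) =
      (cs - m) * Zp⁻¹ * B - I * P3 * R48 * (L1 * N2 * N3 * B / Lp) := by
    simp only [kstar1, kstar2, kstar3]
    exact key
  rw [hgoal]
  -- sizes
  have hZp1 : ‖Zp⁻¹‖ = 1 := by rw [norm_inv, hZp_def, norm_Zpc_eq_one hp hD3 x hre him, inv_one]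
  have hP3n : ‖P3‖ = 1 := norm_pt0_cpow_beta3 c' x ht0
  have hE0 : 0 ≤ E1star c' c₀ x ρ := E1star_nonneg c' c₀ x ρ
  have hℓ : 0 ≤ (ell D ^ 100)⁻¹ := inv_nonneg.mpr (pow_nonneg (by linarith) _)
  calc ‖(cs - m) * Zp⁻¹ * B - I * P3 * R48 * (L1 * N2 * N3 * B / Lp)‖
      ≤ ‖(cs - m) * Zp⁻¹ * B‖ + ‖I * P3 * R48 * (L1 * N2 * N3 * B / Lp)‖ := norm_sub_le _ _
    _ = ‖cs - m‖ * ‖B‖ + ‖R48‖ * ‖L1 * N2 * N3 * B / Lp‖ := by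
        rw [norm_mul, norm_mul, hZp1, mul_one, norm_mul, norm_mul, norm_mul, Complex.norm_I, hP3n,
          one_mul, one_mul]
    _ ≤ C1 * E1star c' c₀ x ρ * ‖B‖ + C2 * (ell D ^ 100)⁻¹ * ‖L1 * N2 * N3 * B / Lp‖ :=
        add_le_add (mul_le_mul_of_nonneg_right hR (norm_nonneg _))
          (mul_le_mul_of_nonneg_right h48ρ (norm_nonneg _))
    _ ≤ max C1 C2 * E1star c' c₀ x ρ * ‖B‖ +
          max C1 C2 * (ell D ^ 100)⁻¹ * ‖L1 * N2 * N3 * B / Lp‖ :=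
        add_le_add
          (mul_le_mul_of_nonneg_right (mul_le_mul_of_nonneg_right (le_max_left _ _) hE0)
            (norm_nonneg _))
          (mul_le_mul_of_nonneg_right (mul_le_mul_of_nonneg_right (le_max_right _ _) hℓ)
            (norm_nonneg _))
    _ = max C1 C2 * (E1star c' c₀ x ρ * ‖B‖ + (ell D ^ 100)⁻¹ * ‖L1 * N2 * N3 * B / Lp‖) := by
        ring

/-- **(13.7), repaired** ("Inserting this into (12.4) we obtain (13.7)", with the Lemma-4.8
remainder carried along): from `Eq133 c′ c₀`, Lemma 4.8 and Proposition 2.2 (i),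
`‖Ξ₁₄ + i(Φ₁ + Φ₂ − Φ₃)‖ ≤ C·(𝓔 + 𝓛⁻¹⁰⁰·ΣΣ‖L(ρ+β₁,ψ)N(ρ+β₂,ψ)N(ρ+β₃,ψ)B(ρ,ψ)/L′(ρ,ψ)‖·|ω(ρ)|)`
(`Ξ₁₄ = ΣΣ𝒞*Z(ρ,χψ)⁻¹Bω` (12.4), `Φⱼ` (13.8)–(13.10), `𝓔` the display after (13.10), all banked).
The printed (13.7) (`Skeleton.Eq137`) is this with the second sum absent.
[cite: Zhang2022LandauSiegel, §13 (13.7) p.75, tex L3788–L3805] -/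
theorem eq137c_of (c' c₀ : ℝ) (h133 : Eq133 c' c₀) (h48 : Lemma48) (h22 : Prop22i) :
    ∃ C : ℝ, ForAllLarge fun D _ χ => AssumptionA D χ →
      ‖xi14 c' χ + I * (Phi1 c' χ + Phi2 c' χ - Phi3 c' χ)‖ ≤
        C * (frakE c' c₀ χ + (ell D ^ 100)⁻¹ * ∑ i ∈ idx χ,
          ‖i.1.ψ.LFunction (i.2 + beta1 c' D) * Nchar D (psiFn i.1) (i.2 + beta2 c' D) *
              Nchar D (psiFn i.1) (i.2 + beta3 c' D) * Bpoly χ i.1 i.2 /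
              deriv i.1.ψ.LFunction i.2‖ * ‖omegaW D i.2‖) := by
  obtain ⟨C, D₀, hC⟩ := u005c_of c' c₀ h133 h48 h22
  refine ⟨C, D₀, fun D _ χ hD hq hp hA => ?_⟩
  have hpt := hC D χ hD hq hp hA
  have key : xi14 c' χ + I * (Phi1 c' χ + Phi2 c' χ - Phi3 c' χ) =
      ∑ i ∈ idx χ, (cstar c' D i.1 i.2 * (Zpc χ i.1 i.2)⁻¹ * Bpoly χ i.1 i.2 +
        I * (kstar1 c' χ i.1 i.2 +
          (((i.1.p : ℝ) * t0 D : ℝ) : ℂ) ^ beta1 c' D * kstar2 c' χ i.1 i.2 -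
          (((i.1.p : ℝ) * t0 D : ℝ) : ℂ) ^ beta3 c' D * kstar3 c' χ i.1 i.2)) * omegaW D i.2 := by
    rw [xi14, Phi1, Phi2, Phi3, ← Finset.sum_add_distrib, ← Finset.sum_sub_distrib, Finset.mul_sum,
      ← Finset.sum_add_distrib]
    refine Finset.sum_congr rfl fun i _ => ?_
    ring
  rw [key, frakE, Finset.mul_sum, mul_add, Finset.mul_sum, Finset.mul_sum, ← Finset.sum_add_distrib]
  refine le_trans (norm_sum_le _ _) (Finset.sum_le_sum fun i hi => ?_)
  have hx : i.1 ∈ PsiOne χ := mem_of_mem_finsetOf (Finset.mem_sigma.mp hi).1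
  have hρ : i.2 ∈ zeroSet D i.1 := mem_of_mem_finsetOf (Finset.mem_sigma.mp hi).2
  have hb := hpt i.1 hx i.2 hρ
  rw [norm_mul]
  calc _ ≤ C * (E1star c' c₀ i.1 i.2 * ‖Bpoly χ i.1 i.2‖ + (ell D ^ 100)⁻¹ *
          ‖i.1.ψ.LFunction (i.2 + beta1 c' D) * Nchar D (psiFn i.1) (i.2 + beta2 c' D) *
              Nchar D (psiFn i.1) (i.2 + beta3 c' D) * Bpoly χ i.1 i.2 /
              deriv i.1.ψ.LFunction i.2‖) * ‖omegaW D i.2‖ := by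
        gcongr
    _ = _ := by ring

/-- **Sufficiency of the repaired chain for the consumed form of (13.7)** (`Skeleton.Eval137 c′`,
the node §18 (18.1) uses via `Skeleton.eval181_of_parts`): from (13.3) (`Eq133 c′ c₀`), Lemma 4.8,
Proposition 2.2 (i), (13.11) (`Skeleton.Eq1311 c′ c₀`: `𝓔 = o(𝔓)`) AND the estimate the printed
chain omits — `𝓛⁻¹⁰⁰·ΣΣ‖L(ρ+β₁,ψ)N(ρ+β₂,ψ)N(ρ+β₃,ψ)B(ρ,ψ)/L′(ρ,ψ)‖·|ω(ρ)| = o(𝔓)` (an extra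
(13.11)-type verification, stated here as a hypothesis, NOT a node of the manuscript) — one gets
`Ξ₁₄ = −i(Φ₁ + Φ₂ − Φ₃) + o(𝔓)`. So, modulo §13's per-zero inputs, the leaf pair
(`Eq137`, `Eq1311`) of `Skeleton.theorem1_of_leaves` may be replaced by
(`Eq133`, `Lemma48`, `Prop22i`, `Eq1311`, this extra estimate). Kernel bookkeeping only.
[cite: Zhang2022LandauSiegel, §13 (13.7), (13.11) p.75] -/
theorem eval137_of_repaired (c' c₀ : ℝ) (h133 : Eq133 c' c₀) (h48 : Lemma48) (h22 : Prop22i)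
    (h1311 : Eq1311 c' c₀)
    (hE' : ∀ ε : ℝ, 0 < ε → ForAllLarge fun D _ χ => AssumptionA D χ →
      (ell D ^ 100)⁻¹ * (∑ i ∈ idx χ,
          ‖i.1.ψ.LFunction (i.2 + beta1 c' D) * Nchar D (psiFn i.1) (i.2 + beta2 c' D) *
              Nchar D (psiFn i.1) (i.2 + beta3 c' D) * Bpoly χ i.1 i.2 /
              deriv i.1.ψ.LFunction i.2‖ * ‖omegaW D i.2‖) ≤ ε * frakP D) :
    Eval137 c' := by
  intro ε hε
  obtain ⟨C, hC⟩ := eq137c_of c' c₀ h133 h48 h22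
  have hε' : 0 < ε / (2 * (|C| + 1)) := by positivity
  obtain ⟨D₀, h⟩ := (hC.and (h1311 _ hε')).and (hE' _ hε')
  refine ⟨D₀, fun D _ χ hD hq hp hA => ?_⟩
  obtain ⟨⟨h1, h2⟩, h3⟩ := h D χ hD hq hp
  have hP : 0 ≤ frakP D := by
    rw [frakP_eq_sum_primeWindow]; exact Finset.sum_nonneg fun p _ => Nat.cast_nonneg p
  have hE0 : 0 ≤ frakE c' c₀ χ := frakE_nonneg c' c₀ χ
  have hS0 : 0 ≤ (ell D ^ 100)⁻¹ * (∑ i ∈ idx χ,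
      ‖i.1.ψ.LFunction (i.2 + beta1 c' D) * Nchar D (psiFn i.1) (i.2 + beta2 c' D) *
          Nchar D (psiFn i.1) (i.2 + beta3 c' D) * Bpoly χ i.1 i.2 /
          deriv i.1.ψ.LFunction i.2‖ * ‖omegaW D i.2‖) :=
    mul_nonneg (inv_nonneg.mpr (pow_nonneg (Real.log_natCast_nonneg D) _))
      (Finset.sum_nonneg fun i _ => mul_nonneg (norm_nonneg _) (norm_nonneg _))
  have hb1 := h2 hA
  have hb2 := h3 hA
  calc ‖xi14 c' χ + I * (Phi1 c' χ + Phi2 c' χ - Phi3 c' χ)‖ ≤ C * _ := h1 hA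
    _ ≤ |C| * (frakE c' c₀ χ + (ell D ^ 100)⁻¹ * (∑ i ∈ idx χ,
          ‖i.1.ψ.LFunction (i.2 + beta1 c' D) * Nchar D (psiFn i.1) (i.2 + beta2 c' D) *
              Nchar D (psiFn i.1) (i.2 + beta3 c' D) * Bpoly χ i.1 i.2 /
              deriv i.1.ψ.LFunction i.2‖ * ‖omegaW D i.2‖)) :=
        mul_le_mul_of_nonneg_right (le_abs_self C) (add_nonneg hE0 hS0)
    _ ≤ |C| * (ε / (2 * (|C| + 1)) * frakP D + ε / (2 * (|C| + 1)) * frakP D) := by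
        gcongr
    _ = (|C| / (|C| + 1)) * (ε * frakP D) := by field_simp; ring
    _ ≤ 1 * (ε * frakP D) :=
        mul_le_mul_of_nonneg_right (by rw [div_le_one (by positivity)]; linarith)
          (mul_nonneg hε.le hP)
    _ = ε * frakP D := one_mul _

end Literature.NumberTheory.LFunctions.Zhang2022.Typed.Section13

end
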